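import Literature.NumberTheory.ComplexMultiplication.TateHalfTransfer
import Literature.NumberTheory.NumberFields.IdelicArtinMapConjugation
import Literature.NumberTheory.NumberFields.IdelicArtinMapTransfer
import Literature.AlgebraicGeometry.Motives.WeilTypeCM
import HarnessLib

/-!
# Tate's half transfer `F_Φ : Γ_ℚ → Γ_E^ab` of a CM type of a CM field, and `F_Φ(σ)·ιF_Φ(σ)ι⁻¹ = Ver_{E/ℚ}(σ)`
# (Milne, *The fundamental theorem of complex multiplication*, arXiv:0705.3446, §4.2; Tate 1981; Blake §1)

Topic `NumberTheory/ComplexMultiplication`; namespace `Literature.NumberTheory.ComplexMultiplication`.  Lane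
`lit-hodgefound` (Track 2, Layer A3 skeleton seat `skel-3`, row A3-G45 FILE 3 of 4: FILE 1 `…/TateHalfTransfer` (the group
theory) instantiated at `G = Γ_ℚ`, `H = res(Γ_E)`, `ι = c` a complex conjugation, with FILE 2
`…/NumberFields/IdelicArtinMapConjugation` and row A3-G44's transfer `…/NumberFields/IdelicArtinMapTransfer`).  Definitions
with bodies (`embOfCoset`, `cosetEquivEmb`, `complexConjRat`, `tateHalfTransfer`) and theorems, all proved; no named fact,
no instance (D-0026, net debt 0).

## The print, verbatim

J. S. Milne, *The fundamental theorem of complex multiplication*, arXiv:0705.3446 [Milne2007FundamentalCM], §4.2 (held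
`paper:arxiv-0705.3446` p0019 L141–p0020 L8): «Thus we can suppose `E ⊂ ℂ` and ignore `i`; then
`F_Φ(σ) = ∏_{φ∈Φ} w_{σφ}⁻¹ σ w_φ mod Aut(ℂ/E^ab)` where the `w_ρ` are elements of `Aut(ℂ)` such that `w_ρ|E = ρ`,
`w_{ιρ} = ιw_ρ`.  PROPOSITION 4.6. For any `σ ∈ Aut(ℂ)`, there is a unique `f_Φ(σ) ∈ 𝔸^×_{f,E}/E^×` such that (a)
`art_E(f_Φ(σ)) = F_Φ(σ)`; (b) `f_Φ(σ)·ιf_Φ(σ) = χ(σ)E^×`, `χ = χ_cyc`.  PROOF. […] We have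
`art_E(f·ιf) = art_E(f)·art_E(ιf) = art_E(f)·ι art_E(f)ι⁻¹ = F_Φ(σ)·F_{ιΦ}(σ) = Ver_{E/ℚ}(σ)`, where
`Ver_{E/ℚ} : Gal(ℚ^al/ℚ)^ab → Gal(ℚ^al/E)^ab` is the transfer (Verlagerung) map. As `Ver_{E/ℚ} = art_E ∘ χ`, it follows
that `f·ιf = χ(σ)E^×` modulo `Ker(art_E)`.»  The `Γ_ℚ`-formulation: C. Blake, *A plectic Taniyama group*, arXiv:1606.03320
[Blake2016PlecticTaniyama] §1 (held p0003 L31–L33): «For any CM number field `K ⊂ Q̄` and CM type `Φ ⊂ Σ_K = Hom(K, Q̄)`,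
Tate wrote down half-transfer map `F_Φ : Γ_ℚ → Γ_K^ab` […] coset representatives `w_ρ` for `Γ_K ⊂ Γ_ℚ` such that
`w_{cρ} = c w_ρ` […] `F_Φ(g) = ∏_{ρ∈Φ} w_{gρ}⁻¹ g w_ρ mod Γ_{K^ab}`.»

## Setting and dictionary (the tree's vocabulary)

`E : Type` a CM number field (Mathlib `IsCMField E`, `ι_E = IsCMField.complexConj E`, `E⁺ = maximalRealSubfield E`);
`Γ_ℚ = absoluteGaloisGroup ℚ = Aut(Q̄)`, `Q̄ = AlgebraicClosure ℚ`; `H = res(Γ_E) = (absGaloisRestrict ℚ E).range ≤ Γ_ℚ` — the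
stabiliser of the tree's fixed embedding `e = absEmbedding ℚ E : E → Q̄` (`…/AbsGaloisOuterConj`), of index `[E:ℚ]`; Blake's
`Σ_K = Hom(K, Q̄)` is the coset space `X = Γ_ℚ ⧸ H` (`gH ↦ g ∘ e`); a complex conjugation is `c ∈ Γ_ℚ` with
`IsComplexConjugation φ c` (`…/AbsGaloisGroup`: `c` acts as `z ↦ z̄` along some `j : Q̄ → ℂ`); `ϕ = absGaloisRangeAbProj ℚ E :
H → Γ_E^ab` (`res σ ↦ [σ]`, row A3-G44), `Ver_{E/ℚ} = absGaloisTransfer ℚ E = MonoidHom.transfer ϕ` (A3-G44 FILE 1),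
`[·, E] = ideleArtinMap E = rec_E = art_E⁻¹` (the tree's sign convention), `(1, χ_cyc σ) = cyclotomicIdele σ ∈ 𝕀_ℚ` (A3-G40),
`con = Units.map (AdeleRing.baseChange ℚ E)`.

## What is formalised

* §1 `X = Γ_ℚ ⧸ H` IS `Hom(E, ℂ)`: along an embedding `j : Q̄ → ℂ`, `embOfCoset E j : gH ↦ j ∘ g ∘ e` is a bijection
  `cosetEquivEmb E j : Γ_ℚ ⧸ H ≃ (E →+* ℂ)` (injective, and both sides have `[E:ℚ]` elements) carrying `c` to complex
  conjugation of embeddings when `j(c•y) = \overline{j y}` (`embOfCoset_smul_eq_conjugate`).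
* §2 For `E` CM and `c` a complex conjugation: `c • (g • e x) = g • e(ι_E x)` (`smul_smul_absEmbedding`), so `c` is CENTRAL and
  FIXED-POINT-FREE on `X` with `c² = 1`; hence `IsCMTypeWith c Ψ ↔ ∀ q, q ∈ Ψ ↔ c • q ∉ Ψ` (`isCMTypeWith_iff`), the preimage of
  a complex CM type `Φ : CMType E` is such a `Ψ` (`isCMTypeWith_preimage_cmType`), and conversely.
* §3 `c` induces `ι_E` on `e(E)`, so FILE 2 gives the continuous involution **`θ_c = absGaloisConj … : Γ_E →ₜ* Γ_E`** («`ι(·)ι⁻¹`»)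
  with `res(θ_c σ) = c·res σ·c⁻¹`, its descent `θ_c^ab`, and the CFT identity **`θ_c^ab [x, E] = [ι_E • x, E]`**
  (`absGaloisConjAb_complexConj_ideleArtinMap`; «`art_E(ιf) = ι art_E(f) ι⁻¹`», from FILE 2 over the Galois pair `E/E⁺`).
* §4 **`tateHalfTransfer E c Ψ : Γ_ℚ → Γ_E^ab`** := FILE 1's `halfTransfer ϕ (1·H) _ c Ψ` — Tate's `F_Φ` — with:
  `tateHalfTransfer_eq_finprod` (the printed product for any symmetric system `w`), **the cocycle identity
  `F_Ψ(στ) = F_{τΨ}(σ)·F_Ψ(τ)`**, `F_Ψ(1) = 1`, **`F_Ψ(c) = 1`**, multiplicativity on the stabiliser of `Ψ`,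
  **`F_Ψ(σ) · θ_c^ab(F_Ψ(σ)) = Ver_{E/ℚ}(σ)`** (`tateHalfTransfer_mul_conj_eq_absGaloisTransfer` — «`F_Φ(σ)·F_{ιΦ}(σ) = Ver_{E/ℚ}(σ)`»
  with «`ιF_Φ(σ)ι⁻¹ = F_{ιΦ}(σ)`») and, by Milne's (37) in the tree (`absGaloisTransfer_rat`, A3-G44),
  **`F_Ψ(σ) · θ_c^ab(F_Ψ(σ)) = [con(1, χ_cyc σ), E]⁻¹`** (`tateHalfTransfer_mul_conj_eq_ideleArtinMap_cyclotomic`).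

NOT HERE: Prop. 4.6 itself (the Taniyama element `f_Φ`: FILE 4 `…/TaniyamaElement`); Prop. 4.9; Lemma 4.5 in its
`Aut(ℂ)`-form (here `σ ∈ Γ_ℚ`; an automorphism of `ℂ` acts through `j⁻¹ σ j`); Theorems 4.1–4.2 (abelian varieties, Layer B).

## References

* J. S. Milne, *The fundamental theorem of complex multiplication*, arXiv:0705.3446 (2007), §4.2 (Lemma 4.4, Prop. 4.6,
  Prop. 4.8), eq. (37). [Milne2007FundamentalCM]
* C. Blake, *A plectic Taniyama group*, arXiv:1606.03320 (2016), §1. [Blake2016PlecticTaniyama]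
* J. Neukirch, *Algebraic Number Theory*, Springer 1999, Ch. IV §5 (5.8), (5.9). [NeukirchANT1999]

## Provenance

Lane `lit-hodgefound`, seat `literature-prover-lit-hodgefound-skel-3-g29-0` (row A3-G45, FILE 3 of 4).
-/

noncomputable section

open scoped Pointwise
open Field NumberField

namespace Literature.NumberTheory.ComplexMultiplication

open Literature.NumberTheory.GaloisRepresentations Literature.NumberTheory.NumberFields
open Literature.AlgebraicGeometry.Motives (CMType)
open HalfTransfer

/-! ### §1. `Γ_ℚ ⧸ res(Γ_E) ≃ Hom(E, ℂ)` along an embedding `j : Q̄ → ℂ` -/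

section Cosets

variable (E : Type) [Field E] [NumberField E] (j : AlgebraicClosure ℚ →+* ℂ)

/-- The embedding `g ∘ e : E → Q̄ → ℂ` attached to `g ∈ Γ_ℚ` (`e = absEmbedding ℚ E`, read in `ℂ` through `j`).
[cite: Blake2016PlecticTaniyama, §1 («Σ_K = Hom(K, Q̄)», «coset representatives w_ρ for Γ_K ⊂ Γ_ℚ»)] -/
def embOfElement (g : absoluteGaloisGroup ℚ) : E →+* ℂ :=
  j.comp (((absoluteGaloisGroup.toAlgEquiv ℚ g) : AlgebraicClosure ℚ →+* AlgebraicClosure ℚ).comp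
    (absEmbedding ℚ E : E →+* AlgebraicClosure ℚ))

/-- Unfolding: `embOfElement E j g x = j (g • e x)`. [cite: Blake2016PlecticTaniyama, §1] -/
@[simp] theorem embOfElement_apply (g : absoluteGaloisGroup ℚ) (x : E) :
    embOfElement E j g x = j (g • (absEmbedding ℚ E x : AlgebraicClosure ℚ)) := rfl

/-- `g ∘ e = g' ∘ e` iff `g⁻¹ g' ∈ res(Γ_E)` (the stabiliser of `e` is `res(Γ_E)`,
`mem_range_absGaloisRestrict_iff_smul_absEmbedding`). [cite: Blake2016PlecticTaniyama, §1] -/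
theorem embOfElement_eq_iff (g g' : absoluteGaloisGroup ℚ) :
    embOfElement E j g = embOfElement E j g' ↔ g⁻¹ * g' ∈ (absGaloisRestrict ℚ E).range := by
  rw [mem_range_absGaloisRestrict_iff_smul_absEmbedding, RingHom.ext_iff]
  refine forall_congr' fun x => ?_
  rw [embOfElement_apply, embOfElement_apply, j.injective.eq_iff, mul_smul, inv_smul_eq_iff, eq_comm]

/-- **`Σ_E`: the embedding `gH ↦ j ∘ g ∘ e` of the coset space `Γ_ℚ ⧸ res(Γ_E)` into `Hom(E, ℂ)`** (well defined and
injective by `embOfElement_eq_iff`). [cite: Blake2016PlecticTaniyama, §1 («Σ_K = Hom(K, Q̄)»)] -/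
def embOfCoset : absoluteGaloisGroup ℚ ⧸ (absGaloisRestrict ℚ E).range → (E →+* ℂ) :=
  Quotient.lift (embOfElement E j) fun g g' h =>
    (embOfElement_eq_iff E j g g').2 (QuotientGroup.leftRel_apply.mp h)

/-- `embOfCoset (gH) = j ∘ g ∘ e`. [cite: Blake2016PlecticTaniyama, §1] -/
@[simp] theorem embOfCoset_mk (g : absoluteGaloisGroup ℚ) :
    embOfCoset E j (g : absoluteGaloisGroup ℚ ⧸ (absGaloisRestrict ℚ E).range) = embOfElement E j g := rfl

/-- `embOfCoset` is injective. [cite: Blake2016PlecticTaniyama, §1] -/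
theorem embOfCoset_injective : Function.Injective (embOfCoset E j) := by
  intro q q' h
  induction q using QuotientGroup.induction_on with
  | H g =>
    induction q' using QuotientGroup.induction_on with
    | H g' =>
      rw [embOfCoset_mk, embOfCoset_mk, embOfElement_eq_iff] at h
      exact QuotientGroup.eq.mpr h

/-- **`Γ_ℚ ⧸ res(Γ_E) ≃ Hom(E, ℂ)`**: `embOfCoset` is a bijection (injective between finite sets of the same size
`[E : ℚ]`: `nat_card_quotient_range_absGaloisRestrict` and `NumberField.Embeddings.card`).
[cite: Blake2016PlecticTaniyama, §1 («Σ_K = Hom(K, Q̄)»)] [cite: Milne2007FundamentalCM, §4.2 («one for each ρ ∈ Hom(E, ℂ)»)] -/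
theorem embOfCoset_bijective : Function.Bijective (embOfCoset E j) := by
  classical
  haveI : Fintype (absoluteGaloisGroup ℚ ⧸ (absGaloisRestrict ℚ E).range) := Fintype.ofFinite _
  refine (Fintype.bijective_iff_injective_and_card _).2 ⟨embOfCoset_injective E j, ?_⟩
  rw [← Nat.card_eq_fintype_card, nat_card_quotient_range_absGaloisRestrict, NumberField.Embeddings.card]

/-- **The bijection `Γ_ℚ ⧸ res(Γ_E) ≃ Hom(E, ℂ)`, `gH ↦ j ∘ g ∘ e`.** [cite: Blake2016PlecticTaniyama, §1] -/
def cosetEquivEmb : absoluteGaloisGroup ℚ ⧸ (absGaloisRestrict ℚ E).range ≃ (E →+* ℂ) :=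
  Equiv.ofBijective (embOfCoset E j) (embOfCoset_bijective E j)

/-- Unfolding. [cite: Blake2016PlecticTaniyama, §1] -/
@[simp] theorem cosetEquivEmb_apply (q : absoluteGaloisGroup ℚ ⧸ (absGaloisRestrict ℚ E).range) :
    cosetEquivEmb E j q = embOfCoset E j q := rfl

variable {j} {c : absoluteGaloisGroup ℚ} (hjc : ∀ y : AlgebraicClosure ℚ, j (c • y) = starRingEnd ℂ (j y))
include hjc

/-- **`c` goes to complex conjugation of embeddings**: if `c` acts as `z ↦ z̄` along `j`, then
`embOfCoset (c • q) = \overline{embOfCoset q}` («`w_{ιρ} = ιw_ρ`» ↔ «`w_{cρ} = c w_ρ`»).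
[cite: Milne2007FundamentalCM, §4.2 (definition of F_Φ)] [cite: Blake2016PlecticTaniyama, §1] -/
theorem embOfCoset_smul_eq_conjugate (q : absoluteGaloisGroup ℚ ⧸ (absGaloisRestrict ℚ E).range) :
    embOfCoset E j (c • q) = ComplexEmbedding.conjugate (embOfCoset E j q) := by
  induction q using QuotientGroup.induction_on with
  | H g =>
    rw [MulAction.Quotient.smul_mk, smul_eq_mul, embOfCoset_mk, embOfCoset_mk]
    exact RingHom.ext fun x => by
      rw [embOfElement_apply, mul_smul, hjc, ComplexEmbedding.conjugate_coe_eq, embOfElement_apply]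

end Cosets

/-! ### §2. A complex conjugation is central and free on `Γ_ℚ ⧸ res(Γ_E)` for `E` CM -/

section CM

variable (E : Type) [Field E] [NumberField E] [IsCMField E] {φ : ℚ →+* ℝ} {c : absoluteGaloisGroup ℚ}
  (hc : IsComplexConjugation φ c)
include hc

/-- **`c • ψ(x) = ψ(ι_E x)` for every embedding `ψ : E → Q̄`** of a CM field and every complex conjugation `c ∈ Γ_ℚ`
(read in `ℂ` along `j`: `\overline{(jψ)(x)} = (jψ)(ι_E x)`, Mathlib `IsCMField.complexEmbedding_complexConj`).
[cite: Milne2007FundamentalCM, §4.1 («Hom(E,ℂ) = Φ ∪ ιΦ»), §4.2] -/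
theorem smul_ringHom_apply (ψ : E →+* AlgebraicClosure ℚ) (x : E) :
    c • ψ x = ψ (IsCMField.complexConj E x) := by
  obtain ⟨j, -, hj⟩ := isComplexConjugation_iff.mp hc
  apply j.injective
  rw [hj]
  exact (IsCMField.complexEmbedding_complexConj (K := E) (j.comp ψ) x).symm

/-- **`c • g • e x = g • e(ι_E x)`** for all `g ∈ Γ_ℚ`, `x ∈ E` (`E` CM). [cite: Milne2007FundamentalCM, §4.2] -/
theorem smul_smul_absEmbedding (g : absoluteGaloisGroup ℚ) (x : E) :
    c • g • (absEmbedding ℚ E x : AlgebraicClosure ℚ) = g • absEmbedding ℚ E (IsCMField.complexConj E x) := by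
  exact smul_ringHom_apply E hc
    (((absoluteGaloisGroup.toAlgEquiv ℚ g) : AlgebraicClosure ℚ →+* AlgebraicClosure ℚ).comp
      (absEmbedding ℚ E : E →+* AlgebraicClosure ℚ)) x

/-- In particular `c • e x = e(ι_E x)`: **`c` induces `ι_E` on the copy `e(E) ⊆ Q̄`** (the hypothesis `hg` of FILE 2's
`absGaloisConj`). [cite: Milne2007FundamentalCM, §4.2] -/
theorem smul_absEmbedding (x : E) :
    c • (absEmbedding ℚ E x : AlgebraicClosure ℚ) = absEmbedding ℚ E (IsCMField.complexConj E x) := by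
  simpa only [one_smul] using smul_smul_absEmbedding E hc 1 x

/-- **`c` is central on `Γ_ℚ ⧸ res(Γ_E)`**: `g • c • q = c • g • q` — «`ι` commutes with every element of `Aut(ℂ)` on
`Hom(E,ℂ)`» for a CM field (`φ ∘ ι_E = \bar φ`). [cite: Milne2007FundamentalCM, §4.2 Lemma 4.4 (proof: «σ permutes the unordered pairs {φ, ιφ}»)] -/
theorem smul_comm_quotient (g : absoluteGaloisGroup ℚ) (q : absoluteGaloisGroup ℚ ⧸ (absGaloisRestrict ℚ E).range) :
    g • c • q = c • g • q := by
  induction q using QuotientGroup.induction_on with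
  | H w =>
    simp only [MulAction.Quotient.smul_mk, smul_eq_mul]
    rw [QuotientGroup.eq, mem_range_absGaloisRestrict_iff_smul_absEmbedding]
    intro x
    rw [mul_smul, inv_smul_eq_iff, mul_smul, mul_smul, mul_smul, mul_smul, smul_smul_absEmbedding E hc,
      ← mul_smul g w, smul_smul_absEmbedding E hc, mul_smul]

omit [IsCMField E] in
/-- `c • c • q = q` on `Γ_ℚ ⧸ res(Γ_E)` (`c² = 1`). [cite: Milne2007FundamentalCM, §4.2] -/
theorem smul_smul_quotient (q : absoluteGaloisGroup ℚ ⧸ (absGaloisRestrict ℚ E).range) : c • c • q = q := by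
  rw [smul_smul, ← pow_two, hc.sq_eq_one, one_smul]

/-- **`c` has no fixed point on `Γ_ℚ ⧸ res(Γ_E)`** (no embedding of a CM field is real: `ι_E ≠ 1`).
[cite: Milne2007FundamentalCM, §4.1 («Φ ∩ ιΦ = ∅»)] -/
theorem smul_quotient_ne (q : absoluteGaloisGroup ℚ ⧸ (absGaloisRestrict ℚ E).range) : c • q ≠ q := by
  induction q using QuotientGroup.induction_on with
  | H w =>
    rw [MulAction.Quotient.smul_mk, smul_eq_mul, Ne, QuotientGroup.eq, mem_range_absGaloisRestrict_iff_smul_absEmbedding]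
    intro h
    apply IsCMField.complexConj_ne_one (K := E)
    refine AlgEquiv.ext fun x => ?_
    have hx := h x
    rw [mul_smul, inv_smul_eq_iff, mul_smul, smul_smul_absEmbedding E hc] at hx
    -- `hx : w • e x = w • e (ι_E x)`
    exact ((absEmbedding ℚ E).injective (MulAction.injective w hx)).symm

/-- **CM types on `Γ_ℚ ⧸ res(Γ_E)`**: `IsCMTypeWith c Ψ ↔ ∀ q, q ∈ Ψ ↔ c • q ∉ Ψ` (centrality and `c² = 1` are automatic).
[cite: Milne2007FundamentalCM, §4.1 («Φ is a CM-type on E, i.e., Hom(E,ℂ) = Φ ∪ ιΦ (disjoint union)»)] -/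
theorem isCMTypeWith_iff (Ψ : Set (absoluteGaloisGroup ℚ ⧸ (absGaloisRestrict ℚ E).range)) :
    IsCMTypeWith c Ψ ↔ ∀ q, q ∈ Ψ ↔ c • q ∉ Ψ :=
  ⟨fun h => h.mem_iff, fun h => ⟨h, smul_comm_quotient E hc, smul_smul_quotient E hc⟩⟩

/-- **A CM type exists** on `Γ_ℚ ⧸ res(Γ_E)` (choose, in each pair `{q, cq}`, the element with the smaller label).
[cite: Milne2007FundamentalCM, §4.2 («choose w_ρ for ρ ∈ Φ (or any other CM-type)»)] -/
theorem exists_isCMTypeWith : ∃ Ψ : Set (absoluteGaloisGroup ℚ ⧸ (absGaloisRestrict ℚ E).range), IsCMTypeWith c Ψ := by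
  obtain ⟨f, hf⟩ := Countable.exists_injective_nat (absoluteGaloisGroup ℚ ⧸ (absGaloisRestrict ℚ E).range)
  refine ⟨{q | f q < f (c • q)}, (isCMTypeWith_iff E hc _).2 fun q => ?_⟩
  simp only [Set.mem_setOf_eq, smul_smul_quotient E hc, not_lt]
  have hne : f q ≠ f (c • q) := fun h => smul_quotient_ne E hc q (hf h).symm
  constructor
  · exact fun h => h.le
  · exact fun h => lt_of_le_of_ne h hne

variable {j : AlgebraicClosure ℚ →+* ℂ} (hjc : ∀ y : AlgebraicClosure ℚ, j (c • y) = starRingEnd ℂ (j y))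

include hjc in
/-- **A complex CM type `Φ : CMType E` read on `Γ_ℚ ⧸ res(Γ_E)` is a CM type for `c`** (pull back along
`cosetEquivEmb E j`, `j` an embedding along which `c` is complex conjugation).
[cite: Milne2007FundamentalCM, §4.1] [cite: Blake2016PlecticTaniyama, §1 («CM type Φ ⊂ Σ_K»)] -/
theorem isCMTypeWith_preimage_cmType (Φ : CMType E) :
    IsCMTypeWith c (embOfCoset E j ⁻¹' Φ.1) :=
  (isCMTypeWith_iff E hc _).2 fun q => by
    rw [Set.mem_preimage, Set.mem_preimage, embOfCoset_smul_eq_conjugate E hjc]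
    exact Φ.2 _

omit [IsCMField E] hc in
include hjc in
/-- Conversely **every CM type for `c` on `Γ_ℚ ⧸ res(Γ_E)` is the pull-back of a unique complex CM type** (push forward
along the bijection `cosetEquivEmb E j`). [cite: Milne2007FundamentalCM, §4.1] -/
theorem exists_unique_cmType_preimage_eq {Ψ : Set (absoluteGaloisGroup ℚ ⧸ (absGaloisRestrict ℚ E).range)}
    (hΨ : IsCMTypeWith c Ψ) : ∃! Φ : CMType E, embOfCoset E j ⁻¹' Φ.1 = Ψ := by
  refine ⟨⟨(cosetEquivEmb E j).symm ⁻¹' Ψ, fun ψ => ?_⟩, ?_, fun Φ hΦ => ?_⟩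
  · obtain ⟨q, rfl⟩ := (cosetEquivEmb E j).surjective ψ
    rw [Set.mem_preimage, Set.mem_preimage, Equiv.symm_apply_apply, cosetEquivEmb_apply,
      ← embOfCoset_smul_eq_conjugate E hjc, ← cosetEquivEmb_apply, Equiv.symm_apply_apply]
    exact hΨ.mem_iff q
  · ext q
    change (cosetEquivEmb E j).symm (cosetEquivEmb E j q) ∈ Ψ ↔ q ∈ Ψ
    rw [Equiv.symm_apply_apply]
  · apply Subtype.ext
    ext ψ
    obtain ⟨q, rfl⟩ := (cosetEquivEmb E j).surjective ψ
    change cosetEquivEmb E j q ∈ Φ.1 ↔ (cosetEquivEmb E j).symm (cosetEquivEmb E j q) ∈ Ψ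
    rw [Equiv.symm_apply_apply, ← hΦ, Set.mem_preimage, cosetEquivEmb_apply]

end CM

/-! ### §3. The involution `θ_c` of `Γ_E^ab` and `θ_c^ab [x, E] = [ι_E • x, E]` -/

section Theta

variable (E : Type) [Field E] [NumberField E] [IsCMField E]

/-- Complex conjugation of a CM field as a `ℚ`-algebra automorphism (Mathlib's `IsCMField.complexConj E` is packaged as
an `E⁺`-algebra automorphism). [cite: Milne2007FundamentalCM, §4.1 («ι_E»)] -/
def complexConjRat : E ≃ₐ[ℚ] E :=
  AlgEquiv.ofRingEquiv (f := (IsCMField.complexConj E : E ≃+* E)) fun q => by simp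

/-- Unfolding. [cite: Milne2007FundamentalCM, §4.1] -/
@[simp] theorem complexConjRat_apply (x : E) : complexConjRat E x = IsCMField.complexConj E x := rfl

variable {E} {φ : ℚ →+* ℝ} {c : absoluteGaloisGroup ℚ} (hc : IsComplexConjugation φ c)
include hc

/-- The hypothesis of FILE 2: `c` induces `ι_E` on `e(E)`. [cite: Milne2007FundamentalCM, §4.2] -/
theorem smul_absEmbedding_eq_complexConjRat (x : E) :
    c • (absEmbedding ℚ E x : AlgebraicClosure ℚ) = absEmbedding ℚ E (complexConjRat E x) :=
  smul_absEmbedding E hc x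

/-- **`θ_c^ab [x, E] = [ι_E • x, E]`** for every idèle `x` of the CM field `E` — «`art_E(ιf) = ι art_E(f)ι⁻¹`»: FILE 2's
`absGaloisConjAb_ideleArtinMap_of_forall_apply_eq` for the Galois pair `E/E⁺` (`ι_E ∈ Gal(E/E⁺)`), where
`θ_c = absGaloisConj (smul_absEmbedding_eq_complexConjRat hc)` is conjugation by `c` and `ι_E •` is the componentwise
Galois action of `…Automorphic/GaloisActionAdeleRing` on `𝕀_E`.
[cite: Milne2007FundamentalCM, §4.2 Prop. 4.6 (proof)] [cite: NeukirchANT1999, Ch. IV §5 Prop. (5.8)] -/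
theorem absGaloisConjAb_complexConj_ideleArtinMap (x : ideleGroup E) :
    absGaloisConjAb (smul_absEmbedding_eq_complexConjRat hc) (ideleArtinMap E x) =
      ideleArtinMap E (IsCMField.complexConj E • x) :=
  absGaloisConjAb_ideleArtinMap_of_forall_apply_eq (K := maximalRealSubfield E)
    (smul_absEmbedding_eq_complexConjRat hc) (IsCMField.complexConj E) (fun _ => rfl) x

/-- `θ_c` is an involution on `Γ_E^ab`: `θ_c^ab (θ_c^ab γ) = γ` (`c² = 1`: `θ_{c²}` is conjugation by `1`).
[cite: Milne2007FundamentalCM, §4.2 Prop. 4.6 (proof)] -/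
theorem absGaloisConjAb_absGaloisConjAb (γ : absoluteGaloisGroupAbelianization E) :
    absGaloisConjAb (smul_absEmbedding_eq_complexConjRat hc)
      (absGaloisConjAb (smul_absEmbedding_eq_complexConjRat hc) γ) = γ := by
  obtain ⟨σ, rfl⟩ := QuotientGroup.mk_surjective γ
  change absGaloisConjAb _ (absGaloisConjAb _ (absGaloisAbProj E σ)) = absGaloisAbProj E σ
  rw [absGaloisConjAb_absGaloisAbProj, absGaloisConjAb_absGaloisAbProj]
  congr 1
  apply absGaloisRestrict_injective ℚ E
  rw [absGaloisRestrict_absGaloisConj, absGaloisRestrict_absGaloisConj]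
  have h2 : c * c = 1 := by rw [← pow_two, hc.sq_eq_one]
  have hinv : c⁻¹ = c := inv_eq_of_mul_eq_one_right h2
  rw [hinv, ← mul_assoc, ← mul_assoc, h2, one_mul, mul_assoc, h2, mul_one]

/-- **The bridge to FILE 1's `ϕ' = ϕ ∘ Inn(c)`**: `ϕ(c h c⁻¹) = θ_c^ab (ϕ h)` for `h ∈ res(Γ_E)`, `ϕ = absGaloisRangeAbProj ℚ E`
(`res(θ_c σ) = c res(σ) c⁻¹`). [cite: Milne2007FundamentalCM, §4.2 Prop. 4.6 (proof: «ι art_E(f) ι⁻¹»)] -/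
theorem absGaloisRangeAbProj_conj (h : (absGaloisRestrict ℚ E).range) (hmem : c * (h : absoluteGaloisGroup ℚ) * c⁻¹ ∈
      (absGaloisRestrict ℚ E).range) :
    absGaloisRangeAbProj ℚ E ⟨c * h * c⁻¹, hmem⟩ =
      ((absGaloisConjAb (smul_absEmbedding_eq_complexConjRat hc)).toMonoidHom.comp (absGaloisRangeAbProj ℚ E)) h := by
  obtain ⟨σ, hσ⟩ := h.2
  have hσ' : absGaloisRestrict ℚ E σ = (h : absoluteGaloisGroup ℚ) := hσ
  change absGaloisRangeAbProj ℚ E ⟨c * h * c⁻¹, hmem⟩ =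
    absGaloisConjAb (smul_absEmbedding_eq_complexConjRat hc) (absGaloisRangeAbProj ℚ E h)
  rw [absGaloisRangeAbProj_eq_of_eq hσ', absGaloisConjAb_absGaloisAbProj]
  refine absGaloisRangeAbProj_eq_of_eq ?_
  change absGaloisRestrict ℚ E _ = c * (h : absoluteGaloisGroup ℚ) * c⁻¹
  rw [absGaloisRestrict_absGaloisConj, hσ']

end Theta

/-! ### §4. Tate's half transfer `F_Φ : Γ_ℚ → Γ_E^ab` -/

section TateHalfTransfer

variable (E : Type) [Field E] [NumberField E]

/-- **Tate's half transfer `F_Ψ : Γ_ℚ → Γ_E^ab` of a CM type `Ψ ⊆ Γ_ℚ ⧸ res(Γ_E) = Hom(E, Q̄)` w.r.t. a complex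
conjugation `c ∈ Γ_ℚ`**: `F_Ψ(σ) = ∏_{ρ∈Ψ} [w_{σρ}⁻¹ σ w_ρ]` for any system of coset representatives `w_ρ` of `res(Γ_E)` in
`Γ_ℚ` with `w_{cρ} = c w_ρ` — FILE 1's `halfTransfer` for `G = Γ_ℚ` acting on `X = Γ_ℚ ⧸ res(Γ_E)`, base point `1·H`,
`ϕ = absGaloisRangeAbProj ℚ E : res(Γ_E) → Γ_E^ab`, `ι = c`.
[cite: Milne2007FundamentalCM, §4.2 («F_Φ(σ) = ∏ w_{σφ}⁻¹σw_φ mod Aut(ℂ/E^ab)»)] [cite: Blake2016PlecticTaniyama, §1 («F_Φ : Γ_ℚ → Γ_K^ab»)] -/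
def tateHalfTransfer (c : absoluteGaloisGroup ℚ) (Ψ : Set (absoluteGaloisGroup ℚ ⧸ (absGaloisRestrict ℚ E).range))
    (σ : absoluteGaloisGroup ℚ) : absoluteGaloisGroupAbelianization E :=
  halfTransfer (absGaloisRangeAbProj ℚ E) ((1 : absoluteGaloisGroup ℚ) : absoluteGaloisGroup ℚ ⧸ (absGaloisRestrict ℚ E).range)
    (mem_iff_smul_quotient_one_eq (H := (absGaloisRestrict ℚ E).range)) c Ψ σ

variable {E} {φ : ℚ →+* ℝ} {c : absoluteGaloisGroup ℚ} (hc : IsComplexConjugation φ c)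
include hc

/-- `c · c = 1` for a complex conjugation. [cite: Milne2007FundamentalCM, §4.2] -/
private theorem mul_self_eq_one_of_isComplexConjugation : c * c = 1 := by rw [← pow_two, hc.sq_eq_one]

variable {Ψ : Set (absoluteGaloisGroup ℚ ⧸ (absGaloisRestrict ℚ E).range)} (hΨ : IsCMTypeWith c Ψ)
include hΨ

omit hc in
/-- **Tate's product formula**: for ANY symmetric system of representatives `w` (`w(q)·H = q`, `w(cq) = c·w(q)`),
`F_Ψ(σ) = ∏_{q∈Ψ} [γ_q]` where `res γ_q = w(σq)⁻¹ σ w(q)` — «independent of the choice of coset representatives» (FILE 1,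
Lemma 4.4). [cite: Milne2007FundamentalCM, §4.2 Lemma 4.4] [cite: Blake2016PlecticTaniyama, §1] -/
theorem tateHalfTransfer_eq_finprod {w : absoluteGaloisGroup ℚ ⧸ (absGaloisRestrict ℚ E).range → absoluteGaloisGroup ℚ}
    (hw : IsSymmSection c ((1 : absoluteGaloisGroup ℚ) : absoluteGaloisGroup ℚ ⧸ (absGaloisRestrict ℚ E).range) w)
    (σ : absoluteGaloisGroup ℚ) {γ : absoluteGaloisGroup ℚ ⧸ (absGaloisRestrict ℚ E).range → absoluteGaloisGroup E}
    (hγ : ∀ q, absGaloisRestrict ℚ E (γ q) = (w (σ • q))⁻¹ * σ * w q) :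
    tateHalfTransfer E c Ψ σ = ∏ᶠ q ∈ Ψ, absGaloisAbProj E (γ q) := by
  rw [tateHalfTransfer, halfTransfer_eq_halfTransferWith _ _ hΨ hw, halfTransferWith_def]
  exact finprod_mem_congr rfl fun q _ => absGaloisRangeAbProj_eq_of_eq (hγ q)

/-- `F_Ψ(1) = 1`. [cite: Milne2007FundamentalCM, §4.2 Prop. 4.8] -/
theorem tateHalfTransfer_one : tateHalfTransfer E c Ψ 1 = 1 :=
  halfTransfer_one _ _ hΨ (mul_self_eq_one_of_isComplexConjugation hc)

/-- **`F_Ψ(c) = 1`** («(c) `f_Φ(ι) = 1`», at the level of `F`). [cite: Milne2007FundamentalCM, §4.2 Prop. 4.8 (c)] -/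
theorem tateHalfTransfer_self : tateHalfTransfer E c Ψ c = 1 :=
  halfTransfer_self _ _ hΨ (mul_self_eq_one_of_isComplexConjugation hc)

/-- **THE COCYCLE IDENTITY `F_Ψ(στ) = F_{τΨ}(σ) · F_Ψ(τ)`** (Prop. 4.8 (a) at the level of `F`: «`F_{τΦ}(σ)·F_Φ(τ) = […]
= F_Φ(στ)`»). [cite: Milne2007FundamentalCM, §4.2 Prop. 4.8 (a)] -/
theorem tateHalfTransfer_mul (σ τ : absoluteGaloisGroup ℚ) :
    tateHalfTransfer E c Ψ (σ * τ) = tateHalfTransfer E c (τ • Ψ) σ * tateHalfTransfer E c Ψ τ :=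
  halfTransfer_mul _ _ hΨ (mul_self_eq_one_of_isComplexConjugation hc) σ τ

/-- `F_Ψ(στ) = F_Ψ(σ)·F_Ψ(τ)` when `τΨ = Ψ`: **`F_Ψ` is a homomorphism on the stabiliser of `Ψ`** (= `Γ_{E*}`, `E*` the
reflex field of the CM type). [cite: Milne2007FundamentalCM, §4.2 Prop. 4.8 (a), Prop. 4.9] -/
theorem tateHalfTransfer_mul_of_smul_eq (σ : absoluteGaloisGroup ℚ) {τ : absoluteGaloisGroup ℚ} (hτ : τ • Ψ = Ψ) :
    tateHalfTransfer E c Ψ (σ * τ) = tateHalfTransfer E c Ψ σ * tateHalfTransfer E c Ψ τ :=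
  halfTransfer_mul_of_smul_eq _ _ hΨ (mul_self_eq_one_of_isComplexConjugation hc) σ hτ

variable [IsCMField E]

/-- **«`ι F_Φ(σ) ι⁻¹ = F_{ιΦ}(σ) = F_{Φᶜ}(σ)`»**: `F_{Ψᶜ}(σ) = θ_c^ab (F_Ψ(σ))`.
[cite: Milne2007FundamentalCM, §4.2 Prop. 4.6 (proof), Prop. 4.8 (b)] -/
theorem tateHalfTransfer_compl (σ : absoluteGaloisGroup ℚ) :
    tateHalfTransfer E c Ψᶜ σ = absGaloisConjAb (smul_absEmbedding_eq_complexConjRat hc) (tateHalfTransfer E c Ψ σ) := by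
  haveI : Finite (absoluteGaloisGroup ℚ ⧸ (absGaloisRestrict ℚ E).range) := inferInstance
  rw [tateHalfTransfer, tateHalfTransfer,
    halfTransfer_compl_eq _ _ hΨ (mul_self_eq_one_of_isComplexConjugation hc) _ (absGaloisRangeAbProj_conj hc) σ]
  exact (map_halfTransfer _ _ hΨ (mul_self_eq_one_of_isComplexConjugation hc)
    (absGaloisConjAb (smul_absEmbedding_eq_complexConjRat hc)).toMonoidHom σ).symm

/-- **«`F_Φ(σ) · ι F_Φ(σ) ι⁻¹ = F_Φ(σ)·F_{ιΦ}(σ) = Ver_{E/ℚ}(σ)`»**: `F_Ψ(σ) · θ_c^ab(F_Ψ(σ)) = absGaloisTransfer ℚ E σ`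
(row A3-G44's transfer `Γ_ℚ → Γ_E^ab`). [cite: Milne2007FundamentalCM, §4.2 Prop. 4.6 (proof)] [cite: NeukirchANT1999, Ch. IV §5 p. 271 (Ver)] -/
theorem tateHalfTransfer_mul_conj_eq_absGaloisTransfer (σ : absoluteGaloisGroup ℚ) :
    tateHalfTransfer E c Ψ σ * absGaloisConjAb (smul_absEmbedding_eq_complexConjRat hc) (tateHalfTransfer E c Ψ σ) =
      absGaloisTransfer ℚ E σ := by
  haveI : (absGaloisRestrict ℚ E).range.FiniteIndex := Subgroup.finiteIndex_of_finite_quotient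
  rw [← tateHalfTransfer_compl hc hΨ, tateHalfTransfer, tateHalfTransfer,
    halfTransfer_mul_halfTransfer_compl_eq_transfer _ hΨ (mul_self_eq_one_of_isComplexConjugation hc)]
  rfl

/-- The same on `Γ_ℚ^ab`: `F_Ψ(σ) · θ_c^ab(F_Ψ(σ)) = Ver_{E/ℚ} [σ]` (`verlagerung ℚ E`).
[cite: Milne2007FundamentalCM, §4.2 Prop. 4.6 (proof)] -/
theorem tateHalfTransfer_mul_conj_eq_verlagerung (σ : absoluteGaloisGroup ℚ) :
    tateHalfTransfer E c Ψ σ * absGaloisConjAb (smul_absEmbedding_eq_complexConjRat hc) (tateHalfTransfer E c Ψ σ) =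
      verlagerung ℚ E (absGaloisAbProj ℚ σ) := by
  rw [tateHalfTransfer_mul_conj_eq_absGaloisTransfer hc hΨ, verlagerung_absGaloisAbProj]

/-- **«As `Ver_{E/ℚ} = art_E ∘ χ` …»: `F_Ψ(σ) · θ_c^ab(F_Ψ(σ)) = [con(1, χ_cyc σ), E]⁻¹`** in the tree's convention
`[·, E] = art_E⁻¹` (Milne's (37) in the tree: `absGaloisTransfer_rat`, row A3-G44).
[cite: Milne2007FundamentalCM, §4 eq. (37), §4.2 Prop. 4.6 (proof)] -/
theorem tateHalfTransfer_mul_conj_eq_ideleArtinMap_cyclotomic (σ : absoluteGaloisGroup ℚ) :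
    tateHalfTransfer E c Ψ σ * absGaloisConjAb (smul_absEmbedding_eq_complexConjRat hc) (tateHalfTransfer E c Ψ σ) =
      (ideleArtinMap E (Units.map (NumberField.AdeleRing.baseChange ℚ E :
        AdeleRing (𝓞 ℚ) ℚ →* AdeleRing (𝓞 E) E) (cyclotomicIdele σ)))⁻¹ := by
  rw [tateHalfTransfer_mul_conj_eq_absGaloisTransfer hc hΨ, absGaloisTransfer_rat]

end TateHalfTransfer

end Literature.NumberTheory.ComplexMultiplication

end
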